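/-
Origin: expansion seat `planner-pub-hodgecm-prl1-g4-0`, handover #2 2026-08-18T07:15:51Z (iff KernelModelAnnihilation lands) (`HOME/pub-hodgecm-prl1-g4/lean/Prl1g4/WeilModelThetaData.lean`, md5 3876fdf5, 250 lines);
landed by the gen-7 packager in gate run 25 as `HodgeCM/Automorphic/WeilModelThetaData.lean` (import ^import Prl1g4\.→import HodgeCM.Automorphic. ×1; import ^import Pv15g2\.→import HodgeCM.Automorphic. ×1).
-/
/-
Origin: HOME/pub-hodgecm-prl1-g4/lean/Prl1g4/WeilModelThetaData.lean — session planner-pub-hodgecm-prl1-g4-0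
(unit pub-hodgecm-prl1-g4, EXPANSION PROVER a-1 gen 4, STRATEGY 1 CONSTRUCT; lineage prl1).
Intended final place (packager's call): `HodgeCM/Automorphic/WeilModelThetaData.lean`.
NEW, ADDITIVE LEAF; WIP imports ↦ landed names: `Prl1g4.WeilThetaModel` ↦ `HodgeCM.Automorphic.WeilThetaModel`
(my HANDOVER #1, 383e508bc906), `Pv15g2.KernelModelAnnihilation` ↦ `HodgeCM.Automorphic.KernelModelAnnihilation`
(pv15-g2 HANDOVER #6 v2, 930de45e797a; its closure: pv15-g2 #1–#5, prl1-g3 #12/#14, pv06-g3 1/4–3/4).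
Lands AFTER both.  My `lean/{Pv15g2,Prl1g3,Pv06g3}/` copies are byte MIRRORS for local elaboration — DO NOT LAND.
KIND: KERNEL + END STATE — nothing cited, nothing posited.
-/
import Summits.HodgeConjecture.HodgeCM.Automorphic.WeilThetaModel
import Summits.HodgeConjecture.HodgeCM.Automorphic.KernelModelAnnihilation

/-!
# The theta carrier over MODELS with the theta side a WEIL THETA MODEL: no structural hypothesis left

pv15-g2's END STATE over models and data (`Assembly.COR_CM_endState_ofKernelModelData`,
`perL_ofKernelModelData`, run 25) has, besides DATA and the cited / labelled inputs, exactly one block of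
unlabelled hypotheses: `hS : D.Structural` — the unit law `ω(1)Φ = Φ`, the continuity of `Φ ↦ θ_Φ`
(PerL v5 l. 343), and the Weil-equivariance `θ_{ω(h)Φ}(ξ, q) = θ_Φ(ξ, h⁻¹ • q)` (l. 414) of the theta kernels.

`WeilThetaModel` (my HANDOVER #1) PROVES all three for the triple `(SK, omg, θ)` it constructs from a Weil datum
[We64] + n° 39 + Théorème 6 BY NAME + the continuity of the theta distribution + the dual-pair splitting.  This file
is the junction:

* §1 `Universe.WeilModelThetaData U` — pv15-g2's `KernelModelThetaData` with its four fields `SK`, `instSK`,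
  `omg`, `θ` REPLACED by one field `wm V c : WeilThetaModel (quotU L ι₁ V).G (quotU L ι₁ V).Γ (quot V c).G
  (quot V c).Γ` per seesaw context; `toKernelModelThetaData` (`SK := ↥(wm V c).SK`, `omg := (wm V c).omg`,
  `θ := (wm V c).θ`);
* §2 **`structural : D.toKernelModelThetaData.Structural`** — the three laws, THEOREMS
  (`WeilThetaModel.omg_one / θ_cont / θ_omg`);
* §3 END STATE **`Assembly.realisationExists_ofWeilModelData`** (`U.RealisationExistsPerL ∧
  U.RealisationExistsFace` — the two `OpenInputs` fields of part (a)), **`perL_ofWeilModelData`**,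
  **`COR_CM_endState_ofWeilModelData`**: pv15-g2's statements with `hS` DISCHARGED.

NET HYPOTHESES of the END STATE (everything else — every structural instance, every named analytic
proposition of PerL §3's carrier (AX1b, AX5b, AX8-provisos, AX9, AX12 (i), (U)), and now the three structural
kernel laws — is a THEOREM of the models):
`M : U.ModelAxioms` · the DATA `D : U.WeilModelThetaData` (two compact Haar quotient models per context; per
context a `WeilThetaModel` = Weil carriers + [P] `act_one` + [DEF+P] `theta_act` + [PRINT BY NAME] n° 39 /
Théorème 6 + [PRINT-DERIVED] `dist_cont` + [class U] splitting `s`, `s_cont`, `s_rat` + [DEF] `SK`,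
`SK_stable`; tori, `emb`, `cover`, sign recipe, theta one-forms) · `hfc` (first countability of `U(W)(𝔸)`) ·
per context and torus side pv06-g3's `QuotientTorusDatum` (Step-2 data; labelled fields [ELEMENTARY] `PT_cov`,
[AX12(ii)] `unfold`, [PRINT] `fourier`, `dense`, …) · the ten theta `Inputs` · `hHR : U.Fact_hodgeRiemann20`
(+ for COR-CM: `h29`, `h30`, the three QW8 facts).
-/

set_option autoImplicit false

noncomputable section

open MeasureTheory Set Filter Function Topology

attribute [-instance] Quotient.instMeasurableSpace

namespace HodgeCM

namespace Universe

open HodgeCM.PerL34 HodgeCM.PerL34.Annihilation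
open HodgeCM.Prior.Perl34File HodgeCM.Prior.Perl34File.Perl34

variable (U : Universe)

/-! ## 1. Kernel-model theta data whose theta side is a Weil theta model -/

/-- **Theta data over quotient models with the theta side a `WeilThetaModel`**: pv15-g2's
`KernelModelThetaData` with `(SK, omg, θ)` replaced by a Weil theta model `wm V c` per seesaw context. -/
structure WeilModelThetaData where
  /-- `[G_U] = G_U(L⁺)\G_U(𝔸)` as a compact Haar quotient -/
  quotU : ∀ (L : CMField) (ι₁ : L →+* ℂ), HermSpace3 L ι₁ → QuotientModel
  /-- degree-two classes of `P_Γ` as `L²` functions on `[G_U]` -/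
  emb : ∀ {L : CMField} {ι₁ : L →+* ℂ} {V : HermSpace3 L ι₁} (Γ : Level V),
    U.CohC (U.pms L ι₁ V Γ) 2 →ₗ[ℂ] (quotU L ι₁ V).H
  /-- the covering `P_{Γ'} → P_Γ` for `Γ' ≤ Γ` -/
  cover : ∀ {L : CMField} {ι₁ : L →+* ℂ} {V : HermSpace3 L ι₁} (Γ Γ' : Level V),
    Γ'.Γ ≤ Γ.Γ → U.Mor (U.pms L ι₁ V Γ') (U.pms L ι₁ V Γ)
  /-- sign recipe, first half -/
  kappa : ∀ (K L : CMField), (K →+* L) → (L →+* ℂ) → (L →+* ℂ) → (K →+* ℂ)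
  /-- sign recipe, second half -/
  frameSign : ∀ (L : CMField), (L →+* ℂ) → (L →+* ℂ) → Bool
  /-- `[U(W)] = U(W)(L₀)\U(W)(𝔸)` as a compact Haar quotient -/
  quot : ∀ {L : CMField} {ι₁ : L →+* ℂ}, HermSpace3 L ι₁ → SeesawCtx L → QuotientModel
  /-- **the Weil theta model of the context**: Weil carriers, n° 39 / Théorème 6 by name, the theta
  distribution, the dual-pair splitting `G_U(𝔸) × U(W)(𝔸) → Mp(𝕎)_A`, the index space `𝒮^κ` -/
  wm : ∀ {L : CMField} {ι₁ : L →+* ℂ} (V : HermSpace3 L ι₁) (c : SeesawCtx L),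
    WeilThetaModel (quotU L ι₁ V).G (quotU L ι₁ V).Γ (quot V c).G (quot V c).Γ
  /-- `T₁₂(𝔸)` -/
  T12 : ∀ {L : CMField} {ι₁ : L →+* ℂ}, HermSpace3 L ι₁ → SeesawCtx L → Type
  /-- `T₃₄(𝔸)` -/
  T34 : ∀ {L : CMField} {ι₁ : L →+* ℂ}, HermSpace3 L ι₁ → SeesawCtx L → Type
  [instT12₁ : ∀ {L : CMField} {ι₁ : L →+* ℂ} (V : HermSpace3 L ι₁) (c : SeesawCtx L), Group (T12 V c)]
  [instT12₂ : ∀ {L : CMField} {ι₁ : L →+* ℂ} (V : HermSpace3 L ι₁) (c : SeesawCtx L), TopologicalSpace (T12 V c)]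
  [instT12₃ : ∀ {L : CMField} {ι₁ : L →+* ℂ} (V : HermSpace3 L ι₁) (c : SeesawCtx L), T2Space (T12 V c)]
  [instT12₄ : ∀ {L : CMField} {ι₁ : L →+* ℂ} (V : HermSpace3 L ι₁) (c : SeesawCtx L), MeasurableSpace (T12 V c)]
  [instT12₅ : ∀ {L : CMField} {ι₁ : L →+* ℂ} (V : HermSpace3 L ι₁) (c : SeesawCtx L),
    OpensMeasurableSpace (T12 V c)]
  [instT34₁ : ∀ {L : CMField} {ι₁ : L →+* ℂ} (V : HermSpace3 L ι₁) (c : SeesawCtx L), Group (T34 V c)]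
  [instT34₂ : ∀ {L : CMField} {ι₁ : L →+* ℂ} (V : HermSpace3 L ι₁) (c : SeesawCtx L), TopologicalSpace (T34 V c)]
  [instT34₃ : ∀ {L : CMField} {ι₁ : L →+* ℂ} (V : HermSpace3 L ι₁) (c : SeesawCtx L), T2Space (T34 V c)]
  [instT34₄ : ∀ {L : CMField} {ι₁ : L →+* ℂ} (V : HermSpace3 L ι₁) (c : SeesawCtx L), MeasurableSpace (T34 V c)]
  [instT34₅ : ∀ {L : CMField} {ι₁ : L →+* ℂ} (V : HermSpace3 L ι₁) (c : SeesawCtx L),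
    OpensMeasurableSpace (T34 V c)]
  /-- the (12) torus side over the kernel-model core of the Weil theta model -/
  kt12 : ∀ {L : CMField} {ι₁ : L →+* ℂ} (V : HermSpace3 L ι₁) (c : SeesawCtx L),
    KernelTorusCarrier
      (KernelModel.core (quotU L ι₁ V) (quot V c) (wm V c).SK (wm V c).omg (wm V c).θ) (T12 V c)
  /-- the (34) torus side over the kernel-model core of the Weil theta model -/
  kt34 : ∀ {L : CMField} {ι₁ : L →+* ℂ} (V : HermSpace3 L ι₁) (c : SeesawCtx L),
    KernelTorusCarrier
      (KernelModel.core (quotU L ι₁ V) (quot V c) (wm V c).SK (wm V c).omg (wm V c).θ) (T34 V c)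
  [instν12 : ∀ {L : CMField} {ι₁ : L →+* ℂ} (V : HermSpace3 L ι₁) (c : SeesawCtx L),
    IsFiniteMeasureOnCompacts (kt12 V c).ν]
  [instν34 : ∀ {L : CMField} {ι₁ : L →+* ℂ} (V : HermSpace3 L ι₁) (c : SeesawCtx L),
    IsFiniteMeasureOnCompacts (kt34 V c).ν]
  /-- the theta one-forms of type `Ψ_i` at level `Γ` -/
  Theta : ∀ {L : CMField} {ι₁ : L →+* ℂ} (V : HermSpace3 L ι₁), SeesawCtx L → Fin 4 → ∀ Γ : Level V,
    Set (U.CohC (U.pms L ι₁ V Γ) 1)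

attribute [instance] WeilModelThetaData.instT12₁ WeilModelThetaData.instT12₂ WeilModelThetaData.instT12₃
  WeilModelThetaData.instT12₄ WeilModelThetaData.instT12₅ WeilModelThetaData.instT34₁
  WeilModelThetaData.instT34₂ WeilModelThetaData.instT34₃ WeilModelThetaData.instT34₄
  WeilModelThetaData.instT34₅ WeilModelThetaData.instν12 WeilModelThetaData.instν34

namespace WeilModelThetaData

variable {U} (D : U.WeilModelThetaData)

/-- **The kernel-model theta data of a Weil-model one**: `SK := ↥(wm V c).SK`, `omg := (wm V c).omg`,
`θ := (wm V c).θ`.  Reducible, for instance search. -/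
abbrev toKernelModelThetaData : U.KernelModelThetaData where
  quotU := D.quotU
  emb := D.emb
  cover := D.cover
  kappa := D.kappa
  frameSign := D.frameSign
  quot := D.quot
  SK := fun V c => (D.wm V c).SK
  omg := fun V c => (D.wm V c).omg
  θ := fun V c => (D.wm V c).θ
  T12 := D.T12
  T34 := D.T34
  kt12 := D.kt12
  kt34 := D.kt34
  Theta := D.Theta

/-- (Ported verbatim from the HodgeCMPerL package; no docstring in the source.) -/
@[simp] theorem toKernelModelThetaData_quot {L : CMField} {ι₁ : L →+* ℂ} (V : HermSpace3 L ι₁) (c : SeesawCtx L) :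
    D.toKernelModelThetaData.quot V c = D.quot V c := rfl

/-- (Ported verbatim from the HodgeCMPerL package; no docstring in the source.) -/
@[simp] theorem toKernelModelThetaData_omg {L : CMField} {ι₁ : L →+* ℂ} (V : HermSpace3 L ι₁) (c : SeesawCtx L) :
    D.toKernelModelThetaData.omg V c = (D.wm V c).omg := rfl

/-- (Ported verbatim from the HodgeCMPerL package; no docstring in the source.) -/
@[simp] theorem toKernelModelThetaData_θ {L : CMField} {ι₁ : L →+* ℂ} (V : HermSpace3 L ι₁) (c : SeesawCtx L) :
    D.toKernelModelThetaData.θ V c = (D.wm V c).θ := rfl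

/-! ## 2. The structural laws are theorems -/

/-- **The three STRUCTURAL laws of the kernel model HOLD over a Weil theta model** — `omg_one`, `θ_cont`
(PerL l. 343), `θ_omg` (l. 414): `WeilThetaModel.omg_one / θ_cont / θ_omg`. -/
theorem structural : D.toKernelModelThetaData.Structural where
  omg_one := fun V c Φ => (D.wm V c).omg_one Φ
  θ_cont := fun V c => (D.wm V c).θ_cont
  θ_omg := fun V c h Φ ξ q => (D.wm V c).θ_omg h Φ ξ q

/-- `AnalyticKM` over a Weil theta model from the two reduced torus datums per context ALONE. -/
theorem analyticKM_of_quotientData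
    (hfc : ∀ {L : CMField} {ι₁ : L →+* ℂ} (V : HermSpace3 L ι₁) (c : SeesawCtx L),
      FirstCountableTopology (D.quot V c).G)
    (A12 : ∀ {L : CMField} {ι₁ : L →+* ℂ} (V : HermSpace3 L ι₁) (c : SeesawCtx L),
      QuotientTorusDatum (D.quot V c).ν (D.toKernelModelThetaData.kcore V c).toRegCoreCarrier.toRepCoreCarrier
        (D.kt12 V c).toRegTorusCarrier.toRepTorusCarrier)
    (A34 : ∀ {L : CMField} {ι₁ : L →+* ℂ} (V : HermSpace3 L ι₁) (c : SeesawCtx L),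
      QuotientTorusDatum (D.quot V c).ν (D.toKernelModelThetaData.kcore V c).toRegCoreCarrier.toRepCoreCarrier
        (D.kt34 V c).toRegTorusCarrier.toRepTorusCarrier) :
    D.toKernelModelThetaData.AnalyticKM :=
  D.toKernelModelThetaData.analyticKM_of_quotientData D.structural hfc A12 A34

end WeilModelThetaData

end Universe

/-! ## 3. END STATE over models whose theta side is a Weil theta model -/

namespace Assembly

open HodgeCM.PerL34 HodgeCM.PerL34.Annihilation
open HodgeCM.Prior.Perl34File HodgeCM.Prior.Perl34File.Perl34
open HodgeCM.Universe (WeilModelThetaData KernelModelThetaData ThetaModel)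

variable (U : Universe)

/-- **Both realisation inputs of part (a) — `RealisationExistsPerL ∧ RealisationExistsFace` — over MODELS whose
theta side is a WEIL THETA MODEL.**  Hypotheses: the model facts `M`; the DATA `D`; first countability of
`U(W)(𝔸)`; per context and torus side the reduced annihilation datum (Prop 3.6 Step 2 data); the ten theta
`Inputs`; Hodge–Riemann for `(2,0)`-forms.  NO structural and NO named analytic hypothesis. -/
theorem realisationExists_ofWeilModelData (M : U.ModelAxioms) (D : U.WeilModelThetaData)
    (hfc : ∀ {L : CMField} {ι₁ : L →+* ℂ} (V : HermSpace3 L ι₁) (c : SeesawCtx L),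
      FirstCountableTopology (D.quot V c).G)
    (A12 : ∀ {L : CMField} {ι₁ : L →+* ℂ} (V : HermSpace3 L ι₁) (c : SeesawCtx L),
      QuotientTorusDatum (D.quot V c).ν (D.toKernelModelThetaData.kcore V c).toRegCoreCarrier.toRepCoreCarrier
        (D.kt12 V c).toRegTorusCarrier.toRepTorusCarrier)
    (A34 : ∀ {L : CMField} {ι₁ : L →+* ℂ} (V : HermSpace3 L ι₁) (c : SeesawCtx L),
      QuotientTorusDatum (D.quot V c).ν (D.toKernelModelThetaData.kcore V c).toRegCoreCarrier.toRepCoreCarrier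
        (D.kt34 V c).toRegTorusCarrier.toRepTorusCarrier)
    (A : (ThetaModel.ofRegCarrier D.toKernelModelThetaData.toKernelThetaCarrier.toRegThetaCarrier
      (D.analyticKM_of_quotientData hfc A12 A34).toAnalytic).Inputs)
    (hHR : U.Fact_hodgeRiemann20) : U.RealisationExistsPerL ∧ U.RealisationExistsFace :=
  realisationExists_ofRegCarrier U M D.toKernelModelThetaData.toKernelThetaCarrier.toRegThetaCarrier
    (D.analyticKM_of_quotientData hfc A12 A34).toAnalytic A hHR

/-- **PerL over models whose theta side is a Weil theta model** — pv15-g2's `perL_ofKernelModelData` with the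
structural hypothesis `hS` DISCHARGED. -/
theorem perL_ofWeilModelData (M : U.ModelAxioms) (D : U.WeilModelThetaData)
    (hfc : ∀ {L : CMField} {ι₁ : L →+* ℂ} (V : HermSpace3 L ι₁) (c : SeesawCtx L),
      FirstCountableTopology (D.quot V c).G)
    (A12 : ∀ {L : CMField} {ι₁ : L →+* ℂ} (V : HermSpace3 L ι₁) (c : SeesawCtx L),
      QuotientTorusDatum (D.quot V c).ν (D.toKernelModelThetaData.kcore V c).toRegCoreCarrier.toRepCoreCarrier
        (D.kt12 V c).toRegTorusCarrier.toRepTorusCarrier)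
    (A34 : ∀ {L : CMField} {ι₁ : L →+* ℂ} (V : HermSpace3 L ι₁) (c : SeesawCtx L),
      QuotientTorusDatum (D.quot V c).ν (D.toKernelModelThetaData.kcore V c).toRegCoreCarrier.toRepCoreCarrier
        (D.kt34 V c).toRegTorusCarrier.toRepTorusCarrier)
    (A : (ThetaModel.ofRegCarrier D.toKernelModelThetaData.toKernelThetaCarrier.toRegThetaCarrier
      (D.analyticKM_of_quotientData hfc A12 A34).toAnalytic).Inputs)
    (hHR : U.Fact_hodgeRiemann20) : U.PerL :=
  perL_ofKernelModelData U M D.toKernelModelThetaData D.structural hfc A12 A34 A hHR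

/-- **COR-CM, END STATE over models whose theta side is a Weil theta model** — pv15-g2's
`COR_CM_endState_ofKernelModelData` with `hS` DISCHARGED.  Hypotheses: `M`, `h29`, `h30`, the QW8 facts, the
DATA `D`, `hfc`, the two reduced torus datums per context, the ten theta `Inputs`, Hodge–Riemann. -/
theorem COR_CM_endState_ofWeilModelData (M : U.ModelAxioms) (h29 : U.Fact_weightSpan)
    (h30 : U.Fact_weightHodge) (hE : U.Qw8ExtProd) (hD : U.Qw8DualPushPull) (hMi : U.Qw8Milne)
    (D : U.WeilModelThetaData)
    (hfc : ∀ {L : CMField} {ι₁ : L →+* ℂ} (V : HermSpace3 L ι₁) (c : SeesawCtx L),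
      FirstCountableTopology (D.quot V c).G)
    (A12 : ∀ {L : CMField} {ι₁ : L →+* ℂ} (V : HermSpace3 L ι₁) (c : SeesawCtx L),
      QuotientTorusDatum (D.quot V c).ν (D.toKernelModelThetaData.kcore V c).toRegCoreCarrier.toRepCoreCarrier
        (D.kt12 V c).toRegTorusCarrier.toRepTorusCarrier)
    (A34 : ∀ {L : CMField} {ι₁ : L →+* ℂ} (V : HermSpace3 L ι₁) (c : SeesawCtx L),
      QuotientTorusDatum (D.quot V c).ν (D.toKernelModelThetaData.kcore V c).toRegCoreCarrier.toRepCoreCarrier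
        (D.kt34 V c).toRegTorusCarrier.toRepTorusCarrier)
    (A : (ThetaModel.ofRegCarrier D.toKernelModelThetaData.toKernelThetaCarrier.toRegThetaCarrier
      (D.analyticKM_of_quotientData hfc A12 A34).toAnalytic).Inputs)
    (hHR : U.Fact_hodgeRiemann20) : U.HC_CM :=
  COR_CM_endState_ofKernelModelData U M h29 h30 hE hD hMi D.toKernelModelThetaData D.structural hfc A12 A34 A hHR

end Assembly

end HodgeCM

end
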